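import Mathlib

/-!
# Route PhotonSphereChannels · BlindnessInsidePhotonSphere — the tortoise radius and the
# Regge–Wheeler potential: regularity, positivity and bounds in the angular momentum `ℓ`

Support file (everything proved) for item stmt-FinalStateConjecture-10049. The route statement
pins the tortoise radius by `r' = 1 − 2M/r`, `r > 2M`, and uses the spin-2 Regge–Wheeler
potential `V_ℓ = (1 − 2M/r)(ℓ(ℓ+1)/r² − 6M/r³) = ℓ(ℓ+1) F − G` with
`F = (1 − 2M/r)/r²`, `G = 6M(1 − 2M/r)/r³`. This file records: `r ∈ C¹` (`contDiff_one_radius`),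
`F, G ∈ C¹`, `F > 0`, the global bound `|V_ℓ| ≤ ℓ(ℓ+1)/(4M²) + 1/M²`, positivity `V_ℓ > 0`
for `ℓ ≥ 2`, and, on a compact interval `K`, constants `f₀ > 0`, `C₀`, `C₁` (independent of
`ℓ`) with `V_ℓ ≥ ℓ(ℓ+1) f₀ − C₀` and the Lipschitz bound
`|V_ℓ(x) − V_ℓ(y)| ≤ (ℓ(ℓ+1) + 1) C₁ |x − y|` on `K` (`potential_compact_bounds`).
Everything is elementary calculus (Regge–Wheeler 1957; Chandrasekhar, *The Mathematical Theory
of Black Holes*, §24). No definitions are introduced.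
-/

noncomputable section

open Set Filter Topology Function

namespace Summit.FinalStateConjecture.FinalStateConjecture.Theorems.Blindness

section Radius

variable {M : ℝ} {r : ℝ → ℝ}

/-- The tortoise radius is `C¹`. -/
theorem contDiff_one_radius (hM : 0 < M) (hr : ∀ x, 2 * M < r x)
    (hr' : ∀ x, HasDerivAt r (1 - 2 * M / r x) x) : ContDiff ℝ 1 r := by
  have hd : Differentiable ℝ r := fun x => (hr' x).differentiableAt
  have hderiv : deriv r = fun x => 1 - 2 * M / r x := funext fun x => (hr' x).deriv
  have hne : ∀ x, r x ≠ 0 := fun x => (lt_trans (by linarith) (hr x)).ne'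
  rw [show (1 : WithTop ℕ∞) = 0 + 1 from (zero_add 1).symm, contDiff_succ_iff_deriv]
  refine ⟨hd, fun h => (WithTop.zero_ne_top h).elim, ?_⟩
  rw [hderiv]
  exact contDiff_zero.2 (continuous_const.sub (continuous_const.div hd.continuous hne))

/-- `r > 0` and `0 < 1 − 2M/r < 1`. -/
theorem radius_facts (hM : 0 < M) (hr : ∀ x, 2 * M < r x) (x : ℝ) :
    0 < r x ∧ 0 < 1 - 2 * M / r x ∧ 1 - 2 * M / r x < 1 := by
  have h1 : 0 < r x := lt_trans (by linarith) (hr x)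
  refine ⟨h1, ?_, ?_⟩
  · rw [sub_pos, div_lt_one h1]; exact hr x
  · have : 0 < 2 * M / r x := div_pos (by linarith) h1
    linarith

/-- `F = (1 − 2M/r)/r²` and `G = 6M(1 − 2M/r)/r³` are `C¹`. -/
theorem contDiff_one_FG (hM : 0 < M) (hr : ∀ x, 2 * M < r x)
    (hr' : ∀ x, HasDerivAt r (1 - 2 * M / r x) x) :
    ContDiff ℝ 1 (fun x => (1 - 2 * M / r x) / r x ^ 2) ∧
      ContDiff ℝ 1 (fun x => 6 * M * (1 - 2 * M / r x) / r x ^ 3) := by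
  have hr1 := contDiff_one_radius hM hr hr'
  have hne : ∀ x, r x ≠ 0 := fun x => (radius_facts hM hr x).1.ne'
  have h1 : ContDiff ℝ 1 fun x => 1 - 2 * M / r x := contDiff_const.sub (contDiff_const.div hr1 hne)
  refine ⟨h1.div (hr1.pow 2) fun x => pow_ne_zero 2 (hne x),
    (contDiff_const.mul h1).div (hr1.pow 3) fun x => pow_ne_zero 3 (hne x)⟩

/-- The Regge–Wheeler potential splits as `V_ℓ = ℓ(ℓ+1) F − G`. -/
theorem potential_split (ℓ : ℕ) (x : ℝ) (hx : r x ≠ 0) :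
    (1 - 2 * M / r x) * ((ℓ : ℝ) * ((ℓ : ℝ) + 1) / r x ^ 2 + (1 - ((2 : ℕ) : ℝ) ^ 2) * (2 * M) / r x ^ 3)
      = (ℓ : ℝ) * ((ℓ : ℝ) + 1) * ((1 - 2 * M / r x) / r x ^ 2)
        - 6 * M * (1 - 2 * M / r x) / r x ^ 3 := by
  have _ := hx
  push_cast
  ring

/-- `V_ℓ ∈ C¹`. -/
theorem contDiff_one_potential (hM : 0 < M) (hr : ∀ x, 2 * M < r x)
    (hr' : ∀ x, HasDerivAt r (1 - 2 * M / r x) x) (ℓ : ℕ) :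
    ContDiff ℝ 1 fun x => (1 - 2 * M / r x) *
      ((ℓ : ℝ) * ((ℓ : ℝ) + 1) / r x ^ 2 + (1 - ((2 : ℕ) : ℝ) ^ 2) * (2 * M) / r x ^ 3) := by
  obtain ⟨hF, hG⟩ := contDiff_one_FG hM hr hr'
  have hne : ∀ x, r x ≠ 0 := fun x => (radius_facts hM hr x).1.ne'
  have heq : (fun x => (1 - 2 * M / r x) *
      ((ℓ : ℝ) * ((ℓ : ℝ) + 1) / r x ^ 2 + (1 - ((2 : ℕ) : ℝ) ^ 2) * (2 * M) / r x ^ 3))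
      = fun x => (ℓ : ℝ) * ((ℓ : ℝ) + 1) * ((1 - 2 * M / r x) / r x ^ 2)
        - 6 * M * (1 - 2 * M / r x) / r x ^ 3 := funext fun x => potential_split ℓ x (hne x)
  rw [heq]
  exact (contDiff_const.mul hF).sub hG

/-- `F > 0`. -/
theorem F_pos (hM : 0 < M) (hr : ∀ x, 2 * M < r x) (x : ℝ) : 0 < (1 - 2 * M / r x) / r x ^ 2 := by
  obtain ⟨h1, h2, -⟩ := radius_facts hM hr x
  positivity

/-- `V_ℓ > 0` for `ℓ ≥ 2`. -/
theorem potential_pos (hM : 0 < M) (hr : ∀ x, 2 * M < r x) {ℓ : ℕ} (hℓ : 2 ≤ ℓ) (x : ℝ) :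
    0 < (1 - 2 * M / r x) *
      ((ℓ : ℝ) * ((ℓ : ℝ) + 1) / r x ^ 2 + (1 - ((2 : ℕ) : ℝ) ^ 2) * (2 * M) / r x ^ 3) := by
  obtain ⟨h1, h2, -⟩ := radius_facts hM hr x
  refine mul_pos h2 ?_
  have hℓ' : (2 : ℝ) ≤ ℓ := by exact_mod_cast hℓ
  have h6 : (6 : ℝ) ≤ (ℓ : ℝ) * ((ℓ : ℝ) + 1) := by nlinarith
  have hrx := hr x
  have key : (ℓ : ℝ) * ((ℓ : ℝ) + 1) / r x ^ 2 + (1 - ((2 : ℕ) : ℝ) ^ 2) * (2 * M) / r x ^ 3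
      = ((ℓ : ℝ) * ((ℓ : ℝ) + 1) * r x - 6 * M) / r x ^ 3 := by
    push_cast
    field_simp
    ring
  rw [key]
  apply div_pos _ (by positivity)
  nlinarith

/-- Global bound `|V_ℓ| ≤ ℓ(ℓ+1)/(4M²) + 1/M²`. -/
theorem abs_potential_le (hM : 0 < M) (hr : ∀ x, 2 * M < r x) (ℓ : ℕ) (x : ℝ) :
    |(1 - 2 * M / r x) *
      ((ℓ : ℝ) * ((ℓ : ℝ) + 1) / r x ^ 2 + (1 - ((2 : ℕ) : ℝ) ^ 2) * (2 * M) / r x ^ 3)|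
      ≤ (ℓ : ℝ) * ((ℓ : ℝ) + 1) / (4 * M ^ 2) + 1 / M ^ 2 := by
  obtain ⟨h1, h2, h3⟩ := radius_facts hM hr x
  have hrx := hr x
  have hℓ : (0 : ℝ) ≤ (ℓ : ℝ) * ((ℓ : ℝ) + 1) := by positivity
  rw [abs_mul, abs_of_pos h2]
  have hA : |(ℓ : ℝ) * ((ℓ : ℝ) + 1) / r x ^ 2 + (1 - ((2 : ℕ) : ℝ) ^ 2) * (2 * M) / r x ^ 3|
      ≤ (ℓ : ℝ) * ((ℓ : ℝ) + 1) / (4 * M ^ 2) + 1 / M ^ 2 := by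
    refine (abs_add_le _ _).trans (add_le_add ?_ ?_)
    · rw [abs_of_nonneg (by positivity)]
      apply div_le_div_of_nonneg_left hℓ (by positivity)
      nlinarith
    · have h8 : (2 * M) ^ 3 < r x ^ 3 := by
        exact pow_lt_pow_left₀ hrx (by linarith) (by norm_num)
      rw [show (1 - ((2 : ℕ) : ℝ) ^ 2) * (2 * M) / r x ^ 3 = -(6 * M / r x ^ 3) by push_cast; ring,
        abs_neg, abs_of_nonneg (by positivity), div_le_div_iff₀ (by positivity) (by positivity)]
      nlinarith [pow_pos hM 2, pow_pos hM 3]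
  calc (1 - 2 * M / r x) *
        |(ℓ : ℝ) * ((ℓ : ℝ) + 1) / r x ^ 2 + (1 - ((2 : ℕ) : ℝ) ^ 2) * (2 * M) / r x ^ 3|
      ≤ 1 * ((ℓ : ℝ) * ((ℓ : ℝ) + 1) / (4 * M ^ 2) + 1 / M ^ 2) :=
        mul_le_mul h3.le hA (abs_nonneg _) zero_le_one
    _ = _ := one_mul _

/-- **Bounds on a compact interval, uniform in `ℓ`.** On `K = [a, b]` there are `f₀ > 0`, `C₀`,
`C₁ ≥ 0` with `V_ℓ(x) ≥ ℓ(ℓ+1) f₀ − C₀` on `K` and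
`|V_ℓ(x) − V_ℓ(y)| ≤ (ℓ(ℓ+1) + 1) C₁ |x − y|` for `x, y ∈ K`, for every `ℓ`. -/
theorem potential_compact_bounds (hM : 0 < M) (hr : ∀ x, 2 * M < r x)
    (hr' : ∀ x, HasDerivAt r (1 - 2 * M / r x) x) {a b : ℝ} (hab : a ≤ b) :
    ∃ f₀ C₀ C₁ : ℝ, 0 < f₀ ∧ 0 ≤ C₀ ∧ 0 ≤ C₁ ∧ ∀ ℓ : ℕ,
      (∀ x ∈ Icc a b, (ℓ : ℝ) * ((ℓ : ℝ) + 1) * f₀ - C₀ ≤ (1 - 2 * M / r x) *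
        ((ℓ : ℝ) * ((ℓ : ℝ) + 1) / r x ^ 2 + (1 - ((2 : ℕ) : ℝ) ^ 2) * (2 * M) / r x ^ 3)) ∧
      (∀ x ∈ Icc a b, ∀ y ∈ Icc a b,
        |(1 - 2 * M / r x) *
            ((ℓ : ℝ) * ((ℓ : ℝ) + 1) / r x ^ 2 + (1 - ((2 : ℕ) : ℝ) ^ 2) * (2 * M) / r x ^ 3)
          - (1 - 2 * M / r y) *
            ((ℓ : ℝ) * ((ℓ : ℝ) + 1) / r y ^ 2 + (1 - ((2 : ℕ) : ℝ) ^ 2) * (2 * M) / r y ^ 3)|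
          ≤ ((ℓ : ℝ) * ((ℓ : ℝ) + 1) + 1) * C₁ * |x - y|) := by
  obtain ⟨hF, hG⟩ := contDiff_one_FG hM hr hr'
  have hne : ∀ x, r x ≠ 0 := fun x => (radius_facts hM hr x).1.ne'
  set F : ℝ → ℝ := fun x => (1 - 2 * M / r x) / r x ^ 2 with hFdef
  set G : ℝ → ℝ := fun x => 6 * M * (1 - 2 * M / r x) / r x ^ 3 with hGdef
  have hK : IsCompact (Icc a b) := isCompact_Icc
  have hKne : (Icc a b).Nonempty := nonempty_Icc.2 hab
  -- `f₀ = min F`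
  obtain ⟨x₀, hx₀, hmin⟩ := hK.exists_isMinOn hKne hF.continuous.continuousOn
  -- bounds for `G`, `F'`, `G'`
  obtain ⟨C₀, hC₀⟩ := hK.exists_bound_of_continuousOn hG.continuous.continuousOn
  obtain ⟨D₁, hD₁⟩ := hK.exists_bound_of_continuousOn (hF.continuous_deriv le_rfl).continuousOn
  obtain ⟨D₂, hD₂⟩ := hK.exists_bound_of_continuousOn (hG.continuous_deriv le_rfl).continuousOn
  refine ⟨F x₀, max C₀ 0, max (max D₁ D₂) 0, F_pos hM hr x₀, le_max_right _ _, le_max_right _ _,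
    fun ℓ => ⟨fun x hx => ?_, fun x hx y hy => ?_⟩⟩
  · rw [potential_split ℓ x (hne x)]
    have h1 : F x₀ ≤ F x := hmin hx
    have h2 : |G x| ≤ max C₀ 0 := ((Real.norm_eq_abs _).symm.le.trans (hC₀ x hx)).trans
      (le_max_left _ _)
    have h3 : G x ≤ max C₀ 0 := (le_abs_self _).trans h2
    have hℓ : (0 : ℝ) ≤ (ℓ : ℝ) * ((ℓ : ℝ) + 1) := by positivity
    show (ℓ : ℝ) * ((ℓ : ℝ) + 1) * F x₀ - max C₀ 0 ≤ (ℓ : ℝ) * ((ℓ : ℝ) + 1) * F x - G x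
    nlinarith [mul_le_mul_of_nonneg_left h1 hℓ]
  · -- mean value inequality for `V = ℓ(ℓ+1) F - G` on the convex set `Icc a b`
    set C₁ := max (max D₁ D₂) 0 with hC₁
    have hC₁0 : 0 ≤ C₁ := le_max_right _ _
    set Vf : ℝ → ℝ := fun x => (ℓ : ℝ) * ((ℓ : ℝ) + 1) * F x - G x with hVf
    have hVd : ∀ z, HasDerivAt Vf ((ℓ : ℝ) * ((ℓ : ℝ) + 1) * deriv F z - deriv G z) z := by
      intro z
      have h1 := ((hF.differentiable one_ne_zero) z).hasDerivAt.const_mul ((ℓ : ℝ) * ((ℓ : ℝ) + 1))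
      have h2 := ((hG.differentiable one_ne_zero) z).hasDerivAt
      exact (h1.sub h2).congr_of_eventuallyEq (Eventually.of_forall fun _ => rfl)
    have hbound : ∀ z ∈ Icc a b, ‖(ℓ : ℝ) * ((ℓ : ℝ) + 1) * deriv F z - deriv G z‖
        ≤ ((ℓ : ℝ) * ((ℓ : ℝ) + 1) + 1) * C₁ := by
      intro z hz
      have h1 : |deriv F z| ≤ C₁ := ((Real.norm_eq_abs _).symm.le.trans (hD₁ z hz)).trans
        ((le_max_left _ _).trans (le_max_left _ _))
      have h2 : |deriv G z| ≤ C₁ := ((Real.norm_eq_abs _).symm.le.trans (hD₂ z hz)).trans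
        ((le_max_right _ _).trans (le_max_left _ _))
      have hℓ : (0 : ℝ) ≤ (ℓ : ℝ) * ((ℓ : ℝ) + 1) := by positivity
      rw [Real.norm_eq_abs]
      calc |(ℓ : ℝ) * ((ℓ : ℝ) + 1) * deriv F z - deriv G z|
          ≤ |(ℓ : ℝ) * ((ℓ : ℝ) + 1) * deriv F z| + |deriv G z| := abs_sub _ _
        _ = (ℓ : ℝ) * ((ℓ : ℝ) + 1) * |deriv F z| + |deriv G z| := by
            rw [abs_mul, abs_of_nonneg hℓ]
        _ ≤ (ℓ : ℝ) * ((ℓ : ℝ) + 1) * C₁ + C₁ := by gcongr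
        _ = ((ℓ : ℝ) * ((ℓ : ℝ) + 1) + 1) * C₁ := by ring
    have hmv := (convex_Icc a b).norm_image_sub_le_of_norm_hasDerivWithin_le
      (fun z hz => (hVd z).hasDerivWithinAt) hbound hy hx
    rw [potential_split ℓ x (hne x), potential_split ℓ y (hne y)]
    simpa [Real.norm_eq_abs, hVf] using hmv

end Radius

end Summit.FinalStateConjecture.FinalStateConjecture.Theorems.Blindness

end
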